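import Literature.NumberTheory.GaloisRepresentations.LocalFieldDyadicPrincipalUnits
import HarnessLib

/-!
# `ℕ` is dense in `𝒪_F` for a local field with residue field `𝔽_p` and `p` a uniformiser (`e = f = 1`, i.e. `𝒪_F ≅ ℤ_p`)

Serre, *Local Fields* (1979), Ch. II §4 Prop. 8 / Ch. I §1: every `x ∈ 𝒪_F` has a `π`-adic expansion with digits in a system of representatives of
`𝓀_F`; when `𝓀_F = 𝔽_p` the digits may be taken in `{0, …, p−1}` and when moreover `π = p` the partial sums are natural numbers, so `ℕ` is dense
in `𝒪_F` (Neukirch, *Algebraic Number Theory* (1999), Ch. II §4 Prop. (4.3) for `ℤ_p`; Mathlib `PadicInt.denseRange_natCast`).  This is the binder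
`hN : DenseRange (Nat.cast : ℕ → 𝒪[K_v])` of the (c)-capstone of the `PrintCf2RubinValueTwo` Coleman lane at a place `v` of DEGREE ONE above `2`
(`LubinTateColemanUnitsImage(Galois)TopologyTwo`: a closed subgroup stable under the Galois/Coleman operators is a `Λ`-submodule because `ℕ` is
dense in the coefficients), stated and PROVED intrinsically for any non-archimedean local field with `#𝓀_F = p` prime and `p` a uniformiser —
no transport from `ℤ_[p]` needed.  Everything PROVED (0 sorry, no definitions, no named facts):

* `exists_natCast_residue_eq` — `#𝓀_F = p` prime ⟹ every residue class has a representative in `ℕ` (`𝓀_F ≅ ℤ/p`);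
* `exists_natCast_dvd_sub` — `p` a uniformiser ⟹ `∀ y ∃ a ∈ ℕ, p ∣ y − a`;
* ★ `exists_natCast_pow_dvd_sub` — `∀ x n, ∃ k ∈ ℕ, p^n ∣ x − k` (the `p`-adic digits);
* `exists_unifValue_pow_lt` — `∀ γ ≠ 0, ∃ n, v(π)^n < γ` (the valuation is discrete of rank one);
* ★★ **`denseRange_natCast_of_isUniformizer_natCast`** — `DenseRange (ℕ → 𝒪_F)`.

Cell `bsd-print-cf2`, width seat `bsd-line-cf2c-w7` g19 (memo BRICK-C-FRAME-g19 F23: the one local binder of the frame-discharged capstone T14 that had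
no discharge in the tree).

## References
* J.-P. Serre, *Local Fields* (1979), Ch. I §1, Ch. II §4 Prop. 8. [SerreLocalFields1979]
* J. Neukirch, *Algebraic Number Theory* (1999), Ch. II §4 Prop. (4.3), §5 Prop. (5.3). [NeukirchANT1999]
* E. de Shalit, *Iwasawa theory of elliptic curves with complex multiplication* (1987), Ch. I §3.3 (`𝒪_𝔭 = ℤ_p` at a split prime). [deShalit1987]
-/

noncomputable section

namespace Literature.NumberTheory.GaloisRepresentations

section NatCastDense

open GaloisRepresentations.IsNonarchimedeanLocalField LubinTate ValuativeRel Topology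

variable {F : Type} [Field F] [ValuativeRel F] [TopologicalSpace F] [IsNonarchimedeanLocalField F]

attribute [local instance] ltNormUniformSpace ltNormIsUniformAddGroup rk1 nF nE fintypeResidueField

variable {p : ℕ} [hp : Fact p.Prime] (hq : residueFieldCard F = p)
  (hπ : (valuation F).IsUniformizer ((((p : ℕ) : 𝒪[F]) : F)))

/-! ### §1. Digits: `p^n ∣ x − k` for some `k ∈ ℕ` -/

include hq in
/-- **Every residue class of `𝒪_F` has a natural-number representative** when `#𝓀_F = p` is prime (`𝓀_F ≅ ℤ/p` as rings).
[cite: SerreLocalFields1979, Ch. I §1] [cite: NeukirchANT1999, Ch. II §4 Prop. (4.3)] -/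
theorem exists_natCast_residue_eq (y : 𝒪[F]) : ∃ a : ℕ, IsLocalRing.residue 𝒪[F] (a : 𝒪[F]) = IsLocalRing.residue 𝒪[F] y := by
  have hcard : Fintype.card 𝓀[F] = p := by rw [← Nat.card_eq_fintype_card]; exact hq
  set e := ZMod.ringEquivOfPrime 𝓀[F] hp.out hcard with he
  obtain ⟨z, hz⟩ := e.surjective (IsLocalRing.residue 𝒪[F] y)
  refine ⟨z.val, ?_⟩
  rw [map_natCast, ← hz, ← map_natCast e, ZMod.natCast_zmod_val]

include hq hπ in
/-- **`p ∣ y − a` for some `a ∈ ℕ`** (`p` a uniformiser: `𝓂_F = (p)`). [cite: SerreLocalFields1979, Ch. II §4 Prop. 8] -/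
theorem exists_natCast_dvd_sub (y : 𝒪[F]) : ∃ a : ℕ, ((p : ℕ) : 𝒪[F]) ∣ y - a := by
  obtain ⟨a, ha⟩ := exists_natCast_residue_eq hq y
  refine ⟨a, ?_⟩
  rw [uniformizer_dvd_iff_mem_maximalIdeal hπ, ← Ideal.Quotient.eq_zero_iff_mem]
  change IsLocalRing.residue 𝒪[F] (y - a) = 0
  rw [map_sub, ha, sub_self]

include hq hπ in
/-- ★ **The `p`-adic digits**: for every `x ∈ 𝒪_F` and `n` there is `k ∈ ℕ` with `p^n ∣ x − k` (induction: `x − k = p^n y`, `y − a = p z` ⟹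
`x − (k + a p^n) = p^{n+1} z`). [cite: SerreLocalFields1979, Ch. II §4 Prop. 8] [cite: NeukirchANT1999, Ch. II §4 Prop. (4.3)] -/
theorem exists_natCast_pow_dvd_sub (x : 𝒪[F]) : ∀ n : ℕ, ∃ k : ℕ, ((p : ℕ) : 𝒪[F]) ^ n ∣ x - k
  | 0 => ⟨0, by simp⟩
  | n + 1 => by
    obtain ⟨k, y, hy⟩ := exists_natCast_pow_dvd_sub x n
    obtain ⟨a, z, hz⟩ := exists_natCast_dvd_sub hq hπ y
    refine ⟨k + a * p ^ n, z, ?_⟩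
    push_cast
    linear_combination hy + ((p : ℕ) : 𝒪[F]) ^ n * hz

/-! ### §2. Density -/

omit hp in
/-- **`∀ γ ≠ 0 ∃ n, v(π)^n < γ`** (the value group is infinite cyclic generated by `v(π) < 1`). [cite: SerreLocalFields1979, Ch. I §1] -/
theorem exists_unifValue_pow_lt (γ : (ValueGroupWithZero F)ˣ) : ∃ n : ℕ, unifValue F ^ n < (γ : ValueGroupWithZero F) := by
  obtain ⟨g, hg⟩ := ValuativeRel.valuation_surjective (γ : ValueGroupWithZero F)
  have hg0 : g ≠ 0 := by rintro rfl; exact γ.ne_zero (by simpa using hg.symm)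
  obtain ⟨m, hm⟩ := exists_valuation_eq_unifValue_zpow F hg0
  refine ⟨m.toNat + 1, ?_⟩
  rw [← hg, hm, ← zpow_natCast]
  exact zpow_lt_zpow_right_of_lt_one₀ (unifValue_pos F) (unifValue_lt_one F) (by push_cast; omega)

include hq hπ in
/-- ★★ **`ℕ` is dense in `𝒪_F`** when `#𝓀_F = p` is prime and `p` is a uniformiser (`𝒪_F ≅ ℤ_p`): for `x ∈ 𝒪_F` and a basic neighbourhood
`{z : v(z − x) < γ}` take `n` with `v(p)^n < γ` and `k ∈ ℕ` with `p^n ∣ x − k`.  The `hN` binder of the (c)-capstone at a place of degree one.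
[cite: SerreLocalFields1979, Ch. II §4 Prop. 8] [cite: NeukirchANT1999, Ch. II §4 Prop. (4.3)] [cite: deShalit1987, Ch. I §3.3] -/
theorem denseRange_natCast_of_isUniformizer_natCast : DenseRange (Nat.cast : ℕ → 𝒪[F]) := by
  intro x
  rw [mem_closure_iff_nhds]
  intro s hs
  obtain ⟨t, ht, hts⟩ := mem_nhds_subtype _ _ _ |>.mp hs
  obtain ⟨γ, hγ⟩ := IsValuativeTopology.mem_nhds_iff'.mp ht
  obtain ⟨n, hn⟩ := exists_unifValue_pow_lt (F := F) γ
  obtain ⟨k, y, hy⟩ := exists_natCast_pow_dvd_sub hq hπ x n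
  refine ⟨(k : 𝒪[F]), hts ?_, ⟨k, rfl⟩⟩
  show ((k : 𝒪[F]) : F) ∈ t
  apply hγ
  show valuation F (((k : 𝒪[F]) : F) - (x : F)) < γ
  have e : ((k : 𝒪[F]) : F) - (x : F) = -((((p : ℕ) : 𝒪[F]) : F) ^ n * (y : F)) := by
    have h := congrArg (fun z : 𝒪[F] => (z : F)) hy
    push_cast at h ⊢
    linear_combination -h
  rw [e, Valuation.map_neg, map_mul, map_pow, hπ]
  calc unifValue F ^ n * valuation F (y : F) ≤ unifValue F ^ n * 1 := by
        gcongr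
        exact y.2
    _ = unifValue F ^ n := mul_one _
    _ < γ := hn

end NatCastDense

end Literature.NumberTheory.GaloisRepresentations

end
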